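import Mathlib
import Literature.RingTheory.CohomologyAnnihilator.Basic
import Literature.RingTheory.CohomologyAnnihilator.Localization
import Summits.ResolutionOfSingularities.ResolutionOfSingularities.Theorems.HomologicalConductorNoZenoDim2RegularCentre
import HarnessLib

/-!
# The canonical `ca`-tower DOES NOT SEE THE GROUND FIELD: re-grounding `k ↦ F` along an intermediate field
# `k ⊆ F ⊆ K` contained in the base algebra

Route `ResolutionOfSingularities/HomologicalConductor`, cruxes `StrictDrop` (stmt-ResolutionOfSingularities-16485) and
`NoZenoR` (stmt-19943), kill test `SurfaceTermination` (stmt-16488); Birth vocabulary `NoZeno.Birth.{ca, loc, chart,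
nrm, tower}` (definitionally the route's `let`-telescope, for ANY ground field).  OURS (cell decomp-res, hand
leafhand-res-homologicalconduct-3); AI-written support lemmas, weaker than expert review; nothing here is a statement
of any manuscript under review.  SUPPORT-level; no stub, crux, route or summit statement is proved here.

All the route's items quantify over EVERY ground field `k` of characteristic `p`.  The operators of the tower are
ring-theoretic — `loc O ·` (fractions with `O`-unit denominators), `chart O ·` (through the cohomology
annihilator, intrinsic under ring isomorphisms: `Literature…ringEquiv_apply_mem_cohomologyAnnihilatorOfDegree`),
`nrm ·` (integral elements) — except that each is an `Algebra.adjoin k`; and `Algebra.adjoin k S`,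
`Algebra.adjoin F S` have the same underlying ring as soon as `F ⊆ k[S]`.  Hence, for an intermediate field
`k ⊆ F ⊆ K` and subalgebras `X` over `k`, `X'` over `F` with the same underlying ring containing `F`:

* `adjoin_toSubring_eq` — `(Algebra.adjoin F S).toSubring = (Algebra.adjoin k S).toSubring` if `F ⊆ k[S]`;
* `exists_ringEquiv_coe_eq`, `ca_eq`, `isIntegral_iff` — the identity ring isomorphism `↥X ≃+* ↥X'` (existence
  form, no definition), and through it `ca X = ca X'` and `IsIntegral ↥X y ↔ IsIntegral ↥X' y`;
* `loc_toSubring_eq`, `chart_toSubring_eq`, `nrm_toSubring_eq`, `step_toSubring_eq`;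
* **`tower_toSubring_eq`** — `(tower O X n).toSubring = (tower O X' n).toSubring` for every `n`;
* `isRegularLocalRing_tower_iff` — so regularity of a stage is the same statement over `k` and over `F`.

Use (re-grounding): a stage `T_m` whose centre has residue field of transcendence degree `r > 0` over `k` contains
a purely transcendental `F = k(t₁,…,t_r)`; over `F` the same tower continues from a finitely generated `F`-model of
`T_m` of Krull dimension `dim T_m`, which is how the kill test `SurfaceTermination` (stated for `dim A = 2` over
any field) reaches the terminal-dimension-two slice of the kernel of `StrictDrop`
(`HomologicalConductorStrictDropKernelTerminalDim`, `…OfSurfaceTermination`).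

References (mechanism only): S. B. Iyengar, R. Takahashi, IMRN 2016, Def. 2.1 [`IyengarTakahashi2014`].
-/

noncomputable section

-- single-problem summit: the doubled namespace component `ResolutionOfSingularities` is forced
set_option linter.dupNamespace false

open Literature.RingTheory.CohomologyAnnihilator

namespace Summit.ResolutionOfSingularities.ResolutionOfSingularities.Theorems.NoZeno.Birth.GroundChange

variable {k K : Type} [Field k] [Field K] [Algebra k K] (F : IntermediateField k K)

/-- **Adjoining over `F` or over `k` gives the same subring as soon as `F` lies in the `k`-algebra generated.**
[folklore] -/
theorem adjoin_toSubring_eq (S : Set K) (hF : (F : Set K) ⊆ Algebra.adjoin k S) :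
    (Algebra.adjoin F S).toSubring = (Algebra.adjoin k S).toSubring := by
  apply le_antisymm
  · -- `Algebra.adjoin k S` is an `F`-subalgebra because it contains `F`
    let B' : Subalgebra F K :=
      { carrier := (Algebra.adjoin k S : Set K)
        mul_mem' := fun ha hb => (Algebra.adjoin k S).mul_mem ha hb
        one_mem' := (Algebra.adjoin k S).one_mem
        add_mem' := fun ha hb => (Algebra.adjoin k S).add_mem ha hb
        zero_mem' := (Algebra.adjoin k S).zero_mem
        algebraMap_mem' := fun c => hF c.2 }
    have hS : S ⊆ (B' : Set K) := Algebra.subset_adjoin (R := k) (s := S)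
    have hle : Algebra.adjoin F S ≤ B' := Algebra.adjoin_le hS
    intro x hx
    exact hle hx
  · have hS : S ⊆ ((Algebra.adjoin F S).restrictScalars k : Set K) :=
      Algebra.subset_adjoin (R := F) (s := S)
    have hle : Algebra.adjoin k S ≤ (Algebra.adjoin F S).restrictScalars k := Algebra.adjoin_le hS
    intro x hx
    exact hle hx

/-- Subalgebras over `k` and over `F` with the same underlying subring are isomorphic rings by the identity on
elements of `K` (existence form; no definition is introduced). [folklore] -/
theorem exists_ringEquiv_coe_eq (X : Subalgebra k K) (X' : Subalgebra F K) (h : X.toSubring = X'.toSubring) :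
    ∃ e : ↥X ≃+* ↥X', ∀ x : ↥X, ((e x : ↥X') : K) = x := by
  have hXX' : ∀ {z : K}, z ∈ X → z ∈ X' := fun {z} hz => by
    have hz' : z ∈ X.toSubring := hz
    rw [h] at hz'
    exact hz'
  have hX'X : ∀ {z : K}, z ∈ X' → z ∈ X := fun {z} hz => by
    have hz' : z ∈ X'.toSubring := hz
    rw [← h] at hz'
    exact hz'
  exact ⟨{ toFun := fun x => ⟨(x : K), hXX' x.2⟩
           invFun := fun x => ⟨(x : K), hX'X x.2⟩
           left_inv := fun x => Subtype.ext rfl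
           right_inv := fun x => Subtype.ext rfl
           map_mul' := fun x y => Subtype.ext rfl
           map_add' := fun x y => Subtype.ext rfl }, fun x => rfl⟩

/-- **`ca` does not see the ground field**: subalgebras over `k` and over `F` with the same underlying ring have
the same cohomology-annihilator set in `K` (`ca` is intrinsic under ring isomorphisms,
`ringEquiv_apply_mem_cohomologyAnnihilatorOfDegree`). [cite: IyengarTakahashi2014, Definition 2.1] -/
theorem ca_eq (X : Subalgebra k K) (X' : Subalgebra F K) (h : X.toSubring = X'.toSubring) :
    ca X = ca X' := by
  have hX : ca X = ((↑) : ↥X → K) '' (cohomologyAnnihilator ↥X : Set ↥X) :=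
    (Subalgebra.image_coe_cohomologyAnnihilator X).symm
  have hX' : ca X' = ((↑) : ↥X' → K) '' (cohomologyAnnihilator ↥X' : Set ↥X') :=
    (Subalgebra.image_coe_cohomologyAnnihilator X').symm
  rw [hX, hX']
  obtain ⟨e, he⟩ := exists_ringEquiv_coe_eq F X X' h
  have he' : ∀ y : ↥X', ((e.symm y : ↥X) : K) = y := fun y => by
    have h1 := he (e.symm y)
    rw [e.apply_symm_apply] at h1
    exact h1.symm
  ext x
  constructor
  · rintro ⟨y, hy, rfl⟩
    refine ⟨e y, ?_, he y⟩
    rw [SetLike.mem_coe, mem_cohomologyAnnihilator_iff] at hy ⊢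
    obtain ⟨n, hn⟩ := hy
    exact ⟨n, ringEquiv_apply_mem_cohomologyAnnihilatorOfDegree e hn⟩
  · rintro ⟨y, hy, rfl⟩
    refine ⟨e.symm y, ?_, he' y⟩
    rw [SetLike.mem_coe, mem_cohomologyAnnihilator_iff] at hy ⊢
    obtain ⟨n, hn⟩ := hy
    exact ⟨n, ringEquiv_apply_mem_cohomologyAnnihilatorOfDegree e.symm hn⟩

/-- **Integrality does not see the ground field**: `y` is integral over `↥X` iff over `↥X'` when the underlying
subrings agree (transport the monic polynomial along the identity isomorphism). [folklore] -/
theorem isIntegral_iff (X : Subalgebra k K) (X' : Subalgebra F K) (h : X.toSubring = X'.toSubring) (y : K) :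
    IsIntegral ↥X y ↔ IsIntegral ↥X' y := by
  obtain ⟨e, he⟩ := exists_ringEquiv_coe_eq F X X' h
  have he' : ∀ y : ↥X', ((e.symm y : ↥X) : K) = y := fun y => by
    have h1 := he (e.symm y)
    rw [e.apply_symm_apply] at h1
    exact h1.symm
  have hcomp : (algebraMap ↥X' K).comp e.toRingHom = algebraMap ↥X K := by
    ext x
    exact he x
  have hcomp' : (algebraMap ↥X K).comp e.symm.toRingHom = algebraMap ↥X' K := by
    ext x
    exact he' x
  constructor
  · rintro ⟨p, hmonic, hp⟩
    refine ⟨p.map e.toRingHom, hmonic.map _, ?_⟩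
    rw [Polynomial.eval₂_map, hcomp]
    exact hp
  · rintro ⟨p, hmonic, hp⟩
    refine ⟨p.map e.symm.toRingHom, hmonic.map _, ?_⟩
    rw [Polynomial.eval₂_map, hcomp']
    exact hp

variable (O : ValuationSubring K)

/-- `loc` over `F` and over `k` agree on subalgebras with the same underlying ring containing `F`. [folklore] -/
theorem loc_toSubring_eq (X : Subalgebra k K) (X' : Subalgebra F K) (h : X.toSubring = X'.toSubring)
    (hFX : (F : Set K) ⊆ X) : (loc O X).toSubring = (loc O X').toSubring := by
  have hset : {y : K | ∃ a ∈ X, ∃ s ∈ X, s⁻¹ ∈ O ∧ y = a * s⁻¹} =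
      {y : K | ∃ a ∈ X', ∃ s ∈ X', s⁻¹ ∈ O ∧ y = a * s⁻¹} := by
    have hmem : ∀ z : K, z ∈ X ↔ z ∈ X' := fun z => by
      rw [← Subalgebra.mem_toSubring, h, Subalgebra.mem_toSubring]
    ext y
    simp only [Set.mem_setOf_eq, hmem]
  unfold loc
  rw [← hset]
  refine (adjoin_toSubring_eq F _ (hFX.trans ?_)).symm
  exact SyzygyFlattening.self_le_locAt O X

/-- `chart` over `F` and over `k` agree on subalgebras with the same underlying ring containing `F`
(the chart set depends only on `ca`, which is intrinsic, `ca_eq`). [folklore] -/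
theorem chart_toSubring_eq (X : Subalgebra k K) (X' : Subalgebra F K) (h : X.toSubring = X'.toSubring)
    (hFX : (F : Set K) ⊆ X) : (chart O X).toSubring = (chart O X').toSubring := by
  have hcoe : (X : Set K) = (X' : Set K) := by
    ext z
    rw [SetLike.mem_coe, SetLike.mem_coe, ← Subalgebra.mem_toSubring, h, Subalgebra.mem_toSubring]
  unfold chart
  rw [← ca_eq F X X' h, ← hcoe]
  refine (adjoin_toSubring_eq F _ (hFX.trans ?_)).symm
  exact fun z hz => Algebra.subset_adjoin (Or.inl hz)

/-- `nrm` over `F` and over `k` agree on subalgebras with the same underlying ring containing `F`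
(`isIntegral_iff`). [folklore] -/
theorem nrm_toSubring_eq (X : Subalgebra k K) (X' : Subalgebra F K) (h : X.toSubring = X'.toSubring)
    (hFX : (F : Set K) ⊆ X) : (nrm X).toSubring = (nrm X').toSubring := by
  have hset : {y : K | IsIntegral ↥X y} = {y : K | IsIntegral ↥X' y} := by
    ext y
    exact isIntegral_iff F X X' h y
  unfold nrm
  rw [← hset]
  refine (adjoin_toSubring_eq F _ (hFX.trans ?_)).symm
  exact SyzygyFlattening.self_le_nrm X

/-- **One step of the tower over `F` and over `k` agree.** [folklore] -/
theorem step_toSubring_eq (X : Subalgebra k K) (X' : Subalgebra F K) (h : X.toSubring = X'.toSubring)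
    (hFX : (F : Set K) ⊆ X) :
    (loc O (nrm (chart O X))).toSubring = (loc O (nrm (chart O X'))).toSubring := by
  have hFc : (F : Set K) ⊆ chart O X := hFX.trans fun z hz => Algebra.subset_adjoin (Or.inl hz)
  have hc := chart_toSubring_eq F O X X' h hFX
  have hFn : (F : Set K) ⊆ nrm (chart O X) := hFc.trans (SyzygyFlattening.self_le_nrm _)
  have hn := nrm_toSubring_eq F (chart O X) (chart O X') hc hFc
  exact loc_toSubring_eq F O (nrm (chart O X)) (nrm (chart O X')) hn hFn

/-- **THE CANONICAL TOWER DOES NOT SEE THE GROUND FIELD.**  For an intermediate field `k ⊆ F ⊆ K` and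
subalgebras `X` over `k`, `X'` over `F` with the same underlying ring containing `F`, every stage of the canonical
normalised `ca`-tower of `X` over `k` has the same underlying ring as the corresponding stage of the tower of `X'`
over `F`: `loc`, `chart` (through the intrinsic `ca`) and `nrm` are ring-theoretic, and `Algebra.adjoin` over `k`
or over `F` agree on sets generating a ring that contains `F`. [folklore] -/
theorem tower_toSubring_eq (X : Subalgebra k K) (X' : Subalgebra F K) (h : X.toSubring = X'.toSubring)
    (hFX : (F : Set K) ⊆ X) (n : ℕ) :
    (tower O X n).toSubring = (tower O X' n).toSubring := by
  induction n with
  | zero =>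
    rw [tower_zero, tower_zero]
    exact loc_toSubring_eq F O X X' h hFX
  | succ n ih =>
    rw [tower_succ, tower_succ]
    have hFn : (F : Set K) ⊆ tower O X n :=
      hFX.trans fun z hz => d2rc_mem_tower_of_le O X (Nat.zero_le n)
        (by rw [tower_zero]; exact SyzygyFlattening.self_le_locAt O X hz)
    exact step_toSubring_eq F O (tower O X n) (tower O X' n) ih hFn

/-- Regularity of a stage transfers across the change of ground field (same underlying ring). [folklore] -/
theorem isRegularLocalRing_tower_iff (X : Subalgebra k K) (X' : Subalgebra F K)
    (h : X.toSubring = X'.toSubring) (hFX : (F : Set K) ⊆ X) (n : ℕ) :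
    IsRegularLocalRing ↥(tower O X n) ↔ IsRegularLocalRing ↥(tower O X' n) := by
  obtain ⟨e, -⟩ := exists_ringEquiv_coe_eq F (tower O X n) (tower O X' n) (tower_toSubring_eq F O X X' h hFX n)
  exact ⟨fun _ => IsRegularLocalRing.of_ringEquiv e, fun _ => IsRegularLocalRing.of_ringEquiv e.symm⟩

end Summit.ResolutionOfSingularities.ResolutionOfSingularities.Theorems.NoZeno.Birth.GroundChange

end
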